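import Literature.Computability.MetaComplexity.AvgCaseDerandomizationPCP
import Literature.Computability.Complexity.PCPAmplification
import HarnessLib

/-!
# Buhrman–Fortnow–Pavan's Lemma 3.7 / Thm. 3.1 from WEAK probabilistically checkable proofs for `E`

Fifth proof file of `AvgCaseDerandomization.lean` (the named fact
`BuhrmanFortnowPavan2004_PromiseBPP'_subset_PromiseP`, BFP Thm. 3.1 in promise form), companion of
`AvgCaseDerandomizationPCP.lean`. There BFP's Lemma 3.7 — hence Thm. 3.1, the `2^{εn}`-hard language in
`E`, and Hirahara's form of Lemma 3.7 — were proved relative to the single inline hypothesis `hPCP`,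
BFP's **Thm. 3.3** (Babai–Fortnow–Levin–Szegedy 1991 / Polishchuk–Spielman 1994: PCPs for `E`) stated
in the tree's model `PCPVerifier` with soundness error `1/2`. The constant `1/2` is immaterial
(Arora–Barak 2009, Remark 11.6 (2): independent repetitions; the tree's `PCPVerifier.andRep`,
`Complexity/PCPAmplification.lean`), so the same conclusions follow from the WEAK form of Thm. 3.3 in
which the verifier of `A ∈ E` is only asked to reject wrong claims with probability `1/(m(n)+1)` for
some polynomial `m`:

  `hW : ∀ A ∈ E, ∃ (V : PCPVerifier) (P : {0,1}* → {0,1}*) (p m : ℕ[X]), V.IsPolyTime ∧`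
  `  (∀ n, V.coins n = p(n)) ∧ P ∈ FE ∧ (∀ x ∈ A, Pr_ρ[V^{π_x}(x; ρ) accepts] = 1) ∧`
  `  (∀ x ∉ A, ∀ π, Pr_ρ[V^π(x; ρ) accepts] ≤ 1 - 1/(m(|x|)+1))`, `π_x(i) = (P x)[i]`.

This is the natural output of an algebraic (sum-check / low-degree-test) verifier, whose soundness
error is a sum of terms `d/|F|` made small but not `1/2` by the choice of the field, and it is the
form in which the PCP theorem for `E` being vendored in the tree (`Complexity/AlgebraicPCP.lean` and
its sequels) can be plugged in without a separate amplification step.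

* `pcpE_of_weak` — `hW` implies `hPCP` (`PCPVerifier.exists_amplified`: `m + 1` repetitions on
  fresh coin blocks, coins `(m+1)(n) · p(n)`, completeness kept, error `(1 - 1/(m+1))^{m+1} ≤ 1/2`);
* **`BFP_lemma37_of_weakPCP_of_DistNP`**, **`BuhrmanFortnowPavan2004_PromiseBPP'_subset_PromiseP_of_weakPCP`**,
  **`exists_hard_E_of_DistNP_subset_AvgP_of_weakPCP`**, **`Hirahara2021_lemma37_of_weakPCP`** — the
  four conclusions of `AvgCaseDerandomizationPCP.lean` from `hW`.

No named fact is introduced (D-0026); `hW`, like `hPCP`, is the theorem of [BFLS91]/[PS94].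

## References

* H. Buhrman, L. Fortnow, A. Pavan, *Some results on derandomization*, Theory Comput. Syst. 38
  (2005) 211–227: Thm. 3.1, Thm. 3.3, Lemma 3.4, Lemma 3.7 [BuhrmanFortnowPavan2004].
* L. Babai, L. Fortnow, L. Levin, M. Szegedy, *Checking computations in polylogarithmic time*,
  STOC 1991, Thm. 1 and §5 [BFLS91]; A. Polishchuk, D. Spielman, STOC 1994.
* S. Arora, B. Barak, *Computational Complexity: A Modern Approach*, CUP 2009, Remark 11.6 (2)
  [AroraBarakCC2009].
* S. Hirahara, ECCC TR21-058 (2021), Lemma 3.4, proof sketch items 2–3 (p. 20) [Hirahara2021].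
-/

noncomputable section

namespace Literature.Computability.MetaComplexity

open _root_.Computability Polynomial Complexity Filter

/-- **PCPs for `E` with soundness error `1 - 1/(m(n)+1)` give PCPs for `E` with error `1/2`** (same
proof strings, `m + 1` independent repetitions). [cite: AroraBarakCC2009, Remark 11.6 (2)] -/
theorem pcpE_of_weak
    (hW : ∀ A ∈ E, ∃ (V : PCPVerifier) (P : List Bool → List Bool) (p m : Polynomial ℕ), V.IsPolyTime ∧
      (∀ n, V.coins n = p.eval n) ∧ P ∈ FE ∧
      (∀ x ∈ A, V.acceptProb x (fun i => (P x).getD i false) = 1) ∧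
      (∀ x ∉ A, ∀ π : ℕ → Bool, V.acceptProb x π ≤ 1 - 1 / (((m.eval x.length : ℕ) : ℝ) + 1))) :
    ∀ A ∈ E, ∃ (V : PCPVerifier) (P : List Bool → List Bool) (p : Polynomial ℕ), V.IsPolyTime ∧
      (∀ n, V.coins n = p.eval n) ∧ P ∈ FE ∧
      (∀ x ∈ A, V.acceptProb x (fun i => (P x).getD i false) = 1) ∧
      (∀ x ∉ A, ∀ π : ℕ → Bool, V.acceptProb x π ≤ 1 / 2) := by
  intro A hA
  obtain ⟨V, P, p, m, hV, hc, hP, hcomp, hsound⟩ := hW A hA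
  obtain ⟨V', hV', hc', hcomp', hsound'⟩ :=
    PCPVerifier.exists_amplified (L := A) (prf := fun x i => (P x).getD i false) hV hc hcomp hsound
  exact ⟨V', P, (m + 1) * p, hV', hc', hP, hcomp', hsound'⟩

/-- **BFP Lemma 3.7 under `DistNP ⊆ AvgP`, from weak PCPs for `E`.**
[cite: BuhrmanFortnowPavan2004, Lemma 3.7, Thm. 3.3] -/
theorem BFP_lemma37_of_weakPCP_of_DistNP
    (hW : ∀ A ∈ E, ∃ (V : PCPVerifier) (P : List Bool → List Bool) (p m : Polynomial ℕ), V.IsPolyTime ∧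
      (∀ n, V.coins n = p.eval n) ∧ P ∈ FE ∧
      (∀ x ∈ A, V.acceptProb x (fun i => (P x).getD i false) = 1) ∧
      (∀ x ∉ A, ∀ π : ℕ → Bool, V.acceptProb x π ≤ 1 - 1 / (((m.eval x.length : ℕ) : ℝ) + 1))) :
    DistNP ⊆ AvgP →
      (∀ A ∈ E, ∀ ε : ℝ, 0 < ε → ∃ᶠ n : ℕ in atTop, (A.circuitSize n : ℝ) ≤ (2 : ℝ) ^ (ε * n)) →
      ∀ A ∈ E, ∃ B ∈ NTIME (fun n => 2 ^ n), ∃ᶠ n : ℕ in atTop,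
        ∀ x : List Bool, x.length = n → (x ∈ A ↔ x ∈ B) :=
  BFP_lemma37_of_pcp_of_DistNP (pcpE_of_weak hW)

/-- **Buhrman–Fortnow–Pavan's Thm. 3.1 (promise form) from weak PCPs for `E`**: the named fact
`BuhrmanFortnowPavan2004_PromiseBPP'_subset_PromiseP` follows from `hW` alone.
[cite: BuhrmanFortnowPavan2004, Thm. 3.1 (proof), Lemma 3.7, Thm. 3.3] -/
theorem BuhrmanFortnowPavan2004_PromiseBPP'_subset_PromiseP_of_weakPCP
    (hW : ∀ A ∈ E, ∃ (V : PCPVerifier) (P : List Bool → List Bool) (p m : Polynomial ℕ), V.IsPolyTime ∧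
      (∀ n, V.coins n = p.eval n) ∧ P ∈ FE ∧
      (∀ x ∈ A, V.acceptProb x (fun i => (P x).getD i false) = 1) ∧
      (∀ x ∉ A, ∀ π : ℕ → Bool, V.acceptProb x π ≤ 1 - 1 / (((m.eval x.length : ℕ) : ℝ) + 1))) :
    BuhrmanFortnowPavan2004_PromiseBPP'_subset_PromiseP :=
  BuhrmanFortnowPavan2004_PromiseBPP'_subset_PromiseP_of_pcp (pcpE_of_weak hW)

/-- **A `2^{εn}`-hard language in `E` from `DistNP ⊆ AvgP` and weak PCPs for `E`.**
[cite: BuhrmanFortnowPavan2004, Thm. 3.1 (proof)] -/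
theorem exists_hard_E_of_DistNP_subset_AvgP_of_weakPCP
    (hW : ∀ A ∈ E, ∃ (V : PCPVerifier) (P : List Bool → List Bool) (p m : Polynomial ℕ), V.IsPolyTime ∧
      (∀ n, V.coins n = p.eval n) ∧ P ∈ FE ∧
      (∀ x ∈ A, V.acceptProb x (fun i => (P x).getD i false) = 1) ∧
      (∀ x ∉ A, ∀ π : ℕ → Bool, V.acceptProb x π ≤ 1 - 1 / (((m.eval x.length : ℕ) : ℝ) + 1)))
    (hD : DistNP ⊆ AvgP) :
    ∃ L ∈ E, ∃ ε : ℝ, 0 < ε ∧ ∀ᶠ n : ℕ in atTop, (2 : ℝ) ^ (ε * n) ≤ (L.circuitSize n : ℝ) :=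
  exists_hard_E_of_DistNP_subset_AvgP_of_pcp (pcpE_of_weak hW) hD

/-- **Lemma 3.7 under Hirahara's hypothesis `coNP × {U, T} ⊆ Avg¹_{1-n^{-c}}P`, from weak PCPs for `E`.**
[cite: Hirahara2021, Lemma 3.4 (proof sketch, items 2–3)] [cite: BuhrmanFortnowPavan2004, Lemma 3.7] -/
theorem Hirahara2021_lemma37_of_weakPCP
    (hW : ∀ A ∈ E, ∃ (V : PCPVerifier) (P : List Bool → List Bool) (p m : Polynomial ℕ), V.IsPolyTime ∧
      (∀ n, V.coins n = p.eval n) ∧ P ∈ FE ∧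
      (∀ x ∈ A, V.acceptProb x (fun i => (P x).getD i false) = 1) ∧
      (∀ x ∉ A, ∀ π : ℕ → Bool, V.acceptProb x π ≤ 1 - 1 / (((m.eval x.length : ℕ) : ℝ) + 1))) :
    (∃ c : ℕ, distClass coNP {uniformEnsemble, tallyEnsemble} ⊆ Avg1DeltaP fun n => 1 - 1 / (n : ℝ) ^ c) →
      (∀ A ∈ E, ∀ ε : ℝ, 0 < ε → ∃ᶠ n : ℕ in atTop, (A.circuitSize n : ℝ) ≤ (2 : ℝ) ^ (ε * n)) →
      ∀ A ∈ E, ∃ B ∈ NTIME (fun n => 2 ^ n), ∃ᶠ n : ℕ in atTop,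
        ∀ x : List Bool, x.length = n → (x ∈ A ↔ x ∈ B) :=
  Hirahara2021_lemma37_of_pcp (pcpE_of_weak hW)

end Literature.Computability.MetaComplexity
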